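import Mathlib
import Summits.Ventures.PercRepro.TriangleCapBandMiddle
import Summits.Ventures.PercRepro.TriangleCapBandThree

/-!
# PercRepro — THE COMPLETE BAND IN CLOSED FORM BY THE DEFICIENCY `d = t − ℓ`, AND BY THE DEPTH `⌊(t + 1)/4⌋`
(p3, gen 53; part 274)

Below the depth `ℓ − 1` the sub-band `u` has the simple width `C(u, 2) + ℓ − 1` (`twoW_of_le`: no collision among
`u ≤ ℓ − 1` carriers), so its overlap with the next one reads `2 (t − ℓ) ≤ u² + 3 u + 4` (`overlap_of_deficiency`):
the depth `u₁` of the first overlap depends on the DEFICIENCY `d = t − ℓ` alone — `u₁ = 0` for `d ≤ 2` (the full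
interval of part 272), `1` for `3 ≤ d ≤ 4`, `2` for `5 ≤ d ≤ 7`, `3` for `8 ≤ d ≤ 11`, `4` for `12 ≤ d ≤ 16`, … —
as long as `u₁ + 1 ≤ ℓ`.  **THE COMPLETE BAND BY THE DEFICIENCY** (`band_complete_deficiency`): for `2 ≤ ℓ`,
`2 t ≤ s`, `1 ≤ u₁ ≤ ℓ − 1`, `2 (t − ℓ) ≤ u₁² + 3 u₁ + 4`, `ℓ + u₁ ≤ t` and `4 (u₁ − 1) + 3 ≤ t ∨ ℓ u₁ < t`, the band
value `2 j` is attained on `ℓ + 1 + (s − t)` vertices IFF `j < B(u₁)` and `B(u) ≤ j ≤ B(u) + C(u, 2) + ℓ − 1` for some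
`u < u₁`, or `B(u₁) ≤ j` and the extremal bound — THE GAPS ARE EXACTLY the intervals
`[u (t − u − 1) + C(u, 2) + ℓ, (u + 1)(t − u − 2) − 1]`, `u < u₁`.

For the small non-neighbourhoods the depth `⌊(t + 1)/4⌋` serves every `ℓ ≥ 4` with `t ≥ 11` and `ℓ + ⌊(t + 1)/4⌋ ≤ t`
(`band_complete_quarter`, the quadratic width of part 270: `(ℓ − 2) u ≥ 2 (ℓ − 1)` for `u ≥ 3`, `ℓ ≥ 4`).  With
parts 266 (`ℓ = 2`), 270 (`ℓ = 3`), 272 (`t ≤ ℓ + 2`) every cell `2 ≤ ℓ ≤ t` has a closed-form description.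
Axioms: standard.
-/

namespace PercRepro

namespace TriangleCap

namespace C047

open Finset

/-- Below the depth `ℓ − 1` the width is `u (u − 1) + 2 (ℓ − 1)` (twice `C(u, 2) + ℓ − 1`). -/
theorem twoW_of_le (ℓ u : ℕ) (hu : u + 1 ≤ ℓ) : twoW ℓ u = u * (u - 1) + 2 * (ℓ - 1) := by
  unfold twoW
  rw [coll_lfRR_zero_of_le (ℓ - 1) u (by omega)]
  have e : u * (u + 1) = u * (u - 1) + 2 * u := by
    rcases u with _ | u'
    · simp
    · rw [Nat.add_sub_cancel]
      ring
  omega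

/-- **THE OVERLAP BY THE DEFICIENCY:** for `u + 1 ≤ ℓ` and `2 (t − ℓ) ≤ u² + 3 u + 4`, the sub-bands `u` and `u + 1`
overlap: `2 B(u + 1) ≤ 2 B(u) + twoW ℓ u + 2`. -/
theorem overlap_of_deficiency (ℓ t u : ℕ) (hu : u + 1 ≤ ℓ) (hd : 2 * (t - ℓ) ≤ u * u + 3 * u + 4) :
    2 * ((u + 1) * (t - u - 2)) ≤ 2 * (u * (t - u - 1)) + twoW ℓ u + 2 := by
  rw [twoW_of_le ℓ u hu]
  rcases Nat.lt_or_ge t (u + 2) with hlt | hge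
  · have e : t - u - 2 = 0 := by omega
    rw [e, mul_zero, mul_zero]
    exact Nat.zero_le _
  · obtain ⟨d, rfl⟩ : ∃ d, t = u + 2 + d := ⟨t - u - 2, by omega⟩
    have e1 : u + 2 + d - u - 2 = d := by omega
    have e2 : u + 2 + d - u - 1 = d + 1 := by omega
    rw [e1, e2]
    have f1 : (u + 1) * d = u * (d + 1) + d - u := by
      have : (u + 1) * d + u = u * (d + 1) + d := by ring
      omega
    have f2 : u * (u - 1) + u = u * u := by
      rcases u with _ | u'
      · simp
      · rw [Nat.add_sub_cancel]
        ring
    have hdu : u * (d + 1) + d ≥ u := by nlinarith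
    omega

/-- **THE COMPLETE BAND BY THE DEFICIENCY `t − ℓ`:** for `2 ≤ ℓ`, `2 t ≤ s`, `1 ≤ u₁`, `u₁ + 1 ≤ ℓ`,
`2 (t − ℓ) ≤ u₁² + 3 u₁ + 4`, `ℓ + u₁ ≤ t` and `4 (u₁ − 1) + 3 ≤ t ∨ ℓ u₁ < t`: the band value `2 j` is attained on
`ℓ + 1 + (s − t)` vertices IFF either `j < u₁ (t − u₁ − 1)` and `u (t − u − 1) ≤ j` with
`2 j ≤ 2 u (t − u − 1) + u (u − 1) + 2 (ℓ − 1)` (i.e. `j ≤ B(u) + C(u, 2) + ℓ − 1`) for some `u < u₁`, or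
`u₁ (t − u₁ − 1) ≤ j` and `2 j + 2 (t / ℓ) t ≤ t (t − 1) + ℓ (t / ℓ)(t / ℓ + 1)`. -/
theorem band_complete_deficiency (ℓ s t u₁ j : ℕ) (hℓ : 2 ≤ ℓ) (hs : 2 * t ≤ s) (hu : 1 ≤ u₁) (hu₁ℓ : u₁ + 1 ≤ ℓ)
    (hd : 2 * (t - ℓ) ≤ u₁ * u₁ + 3 * u₁ + 4) (hℓt : ℓ + u₁ ≤ t) (hstruct : 4 * (u₁ - 1) + 3 ≤ t ∨ ℓ * u₁ < t) :
    (∃ (H : SimpleGraph (Fin (ℓ + 1 + (s - t)))) (_ : DecidableRel H.Adj), H.CliqueFree 3 ∧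
      H.edgeFinset.card = s ∧ (∃ w, deg H w + t = s) ∧
      ∑ v, deg H v * deg H v + 2 * (t * (s - t - 1)) + 2 * j = s * (s + 1)) ↔
    ((j < u₁ * (t - u₁ - 1) ∧ ∃ u, u + 1 ≤ u₁ ∧ u * (t - u - 1) ≤ j ∧
        2 * j ≤ 2 * (u * (t - u - 1)) + u * (u - 1) + 2 * (ℓ - 1)) ∨
      (u₁ * (t - u₁ - 1) ≤ j ∧ 2 * j + 2 * (t / ℓ) * t ≤ t * (t - 1) + ℓ * ((t / ℓ) * (t / ℓ + 1)))) := by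
  have hov := overlap_of_deficiency ℓ t u₁ hu₁ℓ hd
  rw [band_complete' ℓ s t u₁ j hℓ (by omega) hs hu (by omega) hℓt hov hstruct]
  -- the tangent bound at `q = 1` is the simple width for `u ≤ ℓ − 2`
  have hconv : ∀ u, u + 1 ≤ u₁ →
      (2 * j + 2 * (subQ ℓ u * u) ≤ 2 * (u * (t - u - 1)) + u * (u + 1) + (ℓ - 1) * (subQ ℓ u * (subQ ℓ u + 1)) ↔
        2 * j ≤ 2 * (u * (t - u - 1)) + u * (u - 1) + 2 * (ℓ - 1)) := by
    intro u hu'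
    have hq : subQ ℓ u = 1 := by
      unfold subQ
      rw [Nat.div_eq_of_lt (by omega), max_eq_left (Nat.zero_le 1)]
    rw [hq]
    have e : u * (u + 1) = u * (u - 1) + 2 * u := by
      rcases u with _ | u'
      · simp
      · rw [Nat.add_sub_cancel]
        ring
    omega
  constructor
  · rintro (⟨hj, u, hu', hlow, hup⟩ | h)
    · exact Or.inl ⟨hj, u, hu', hlow, (hconv u hu').mp hup⟩
    · exact Or.inr h
  · rintro (⟨hj, u, hu', hlow, hup⟩ | h)
    · exact Or.inl ⟨hj, u, hu', hlow, (hconv u hu').mpr hup⟩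
    · exact Or.inr h

/-- **THE OVERLAP AT THE DEPTH `⌊(t + 1)/4⌋`, EVERY `ℓ ≥ 4`, `t ≥ 11`** (the quadratic width of part 270). -/
theorem overlap_quarter (ℓ t : ℕ) (hℓ : 4 ≤ ℓ) (ht : 11 ≤ t) :
    2 * (((t + 1) / 4 + 1) * (t - (t + 1) / 4 - 2)) ≤
      2 * (((t + 1) / 4) * (t - (t + 1) / 4 - 1)) + twoW ℓ ((t + 1) / 4) + 2 := by
  apply overlap_of_sq ℓ t ((t + 1) / 4) (by omega)
  have hu3 : 3 ≤ (t + 1) / 4 := by omega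
  have hu4 : t ≤ 4 * ((t + 1) / 4) + 2 := by omega
  obtain ⟨u, hu⟩ : ∃ u, (t + 1) / 4 = u := ⟨_, rfl⟩
  rw [hu] at hu3 hu4 ⊢
  obtain ⟨k, rfl⟩ : ∃ k, ℓ = k + 4 := ⟨ℓ - 4, by omega⟩
  have e1 : k + 4 - 1 = k + 3 := by omega
  have e2 : k + 4 - 2 = k + 2 := by omega
  rw [e1, e2]
  have hsub : t - 2 * u - 2 ≤ 2 * u := by omega
  obtain ⟨v, rfl⟩ : ∃ v, u = v + 3 := ⟨u - 3, by omega⟩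
  calc 2 * ((k + 3) * (t - 2 * (v + 3) - 2)) ≤ 2 * ((k + 3) * (2 * (v + 3))) := by gcongr
    _ ≤ (k + 2) * ((v + 3) * (v + 3 + 1)) + 2 * (v + 3) + 2 * (k + 3) := by
      nlinarith [Nat.zero_le (k * (v * v)), Nat.zero_le (k * v), Nat.zero_le (v * v)]

/-- **THE COMPLETE BAND AT THE DEPTH `⌊(t + 1)/4⌋`, EVERY `ℓ ≥ 4`** (`11 ≤ t`, `ℓ + ⌊(t + 1)/4⌋ ≤ t`, `2 t ≤ s`): the
band value `2 j` is attained on `ℓ + 1 + (s − t)` vertices IFF `j < B(u₁)` and `j` lies in a sub-band interval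
`u < u₁` (the tangent bound at `q = subQ ℓ u`), or `B(u₁) ≤ j` and the extremal bound, `u₁ = ⌊(t + 1)/4⌋`. -/
theorem band_complete_quarter (ℓ s t j : ℕ) (hℓ : 4 ≤ ℓ) (ht : 11 ≤ t) (hℓt : ℓ + (t + 1) / 4 ≤ t) (hs : 2 * t ≤ s) :
    (∃ (H : SimpleGraph (Fin (ℓ + 1 + (s - t)))) (_ : DecidableRel H.Adj), H.CliqueFree 3 ∧
      H.edgeFinset.card = s ∧ (∃ w, deg H w + t = s) ∧
      ∑ v, deg H v * deg H v + 2 * (t * (s - t - 1)) + 2 * j = s * (s + 1)) ↔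
    ((j < ((t + 1) / 4) * (t - (t + 1) / 4 - 1) ∧ ∃ u, u + 1 ≤ (t + 1) / 4 ∧ u * (t - u - 1) ≤ j ∧
        2 * j + 2 * (subQ ℓ u * u) ≤ 2 * (u * (t - u - 1)) + u * (u + 1) + (ℓ - 1) * (subQ ℓ u * (subQ ℓ u + 1))) ∨
      (((t + 1) / 4) * (t - (t + 1) / 4 - 1) ≤ j ∧
        2 * j + 2 * (t / ℓ) * t ≤ t * (t - 1) + ℓ * ((t / ℓ) * (t / ℓ + 1)))) := by
  apply band_complete' ℓ s t ((t + 1) / 4) j (by omega) (by omega) hs (by omega) (by omega) hℓt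
  · exact overlap_quarter ℓ t hℓ ht
  · left
    omega

end C047

end TriangleCap

end PercRepro
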